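import Summits.RiemannHypothesis.RiemannHypothesis.Theses.WeilComb
import Summits.RiemannHypothesis.RiemannHypothesis.Theorems.WeilCombCombSubcriticalStubIdentity
import Summits.RiemannHypothesis.RiemannHypothesis.Theorems.WeilCombCombHelsonBound
import Literature.NumberTheory.LFunctions.RosserSchoenfeldVonMangoldtSum

/-!
# Stub `stub_helson_upper` of line `Sketch` for crux `WeilComb.CombShapePositivity`
(item stmt-RiemannHypothesis-11229, route route-RiemannHypothesis-WeilComb)

The von Mangoldt Helson form lies below the diagonal, minus the multiplicative Dirichlet energy:
for every `M : ℕ` and every `a : ℕ → ℂ`,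

`H(a) ≤ (log M + 1) ‖a‖² − D(a)`,

where `H(a) = 2 Re Σ_{m ≤ M} Σ_{n ≤ M/m} Λ(n) n^{-1/2} a(nm) conj a(m)` (the Λ-Helson form),
`‖a‖² = Σ_{m ≤ M} ‖a m‖²`, and `D(a) = Σ_{m ≤ M} Σ_{n ≤ M/m} Λ(n) ‖a(nm) − n^{-1/2} a(m)‖²`
(the Dirichlet energy of the von Mangoldt divisor graph in the Perron gauge `n^{-1/2}`).

Proof. Two landed steps:
* the ground-state identity `H(a) = Σ_{m ≤ M} ‖a m‖² (log m + ψ₁(M/m)) − D(a)` with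
  `ψ₁(y) = Σ_{n ≤ y} Λ(n)/n`
  (`Summit.RiemannHypothesis.RiemannHypothesis.Theorems.WeilCombSubcritical.stub_identity`);
* termwise, for `1 ≤ m ≤ M`, `log m + ψ₁(M/m) < log m + log(M/m) + 1 = log M + 1`, by the explicit
  Mertens bound `Σ_{n ≤ x} Λ(n)/n < log x + 1` (`x ≥ 1`) of Rosser–Schoenfeld 1962, (3.24) with (2.8)
  (`Literature.NumberTheory.LFunctions.RosserSchoenfeld.sum_vonMangoldt_div_lt_log_add_one`, packaged
  at `x = M/m` as `Summit.RiemannHypothesis.RiemannHypothesis.Theorems.WeilComb.log_add_sum_vonMangoldt_div_le`).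
Multiplying by `‖a m‖² ≥ 0` and summing over `m ≤ M` gives the claim (for `M = 0` every sum is empty).

Sources: J. B. Rosser, L. Schoenfeld, *Approximate formulas for some functions of prime numbers*,
Illinois J. Math. 6 (1962), 64–94, Cor. (3.24) p. 70 (with (2.8), (2.11)).

Unconditional; standard axioms.
-/

noncomputable section

-- the sub-problem path `RiemannHypothesis/RiemannHypothesis` (single-conjunct summit) duplicates a namespace
set_option linter.dupNamespace false

open scoped BigOperators ComplexConjugate
open Complex MeasureTheory Set

namespace Summit.RiemannHypothesis.RiemannHypothesis.Theorems.WeilCombBohrFejer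

open Literature.NumberTheory.LFunctions

/-- **Stub B3 — Helson form below the diagonal, minus the Dirichlet energy.**
`⟨S_M a, a⟩ ≤ (log M + 1) ‖a‖² − D(a)`: the ground-state identity
`⟨S_M a, a⟩ = Σ_m ‖a_m‖² (log m + ψ₁(M/m)) − D(a)` (`WeilCombSubcritical.stub_identity`) and
`log m + ψ₁(M/m) ≤ log M + 1` for `1 ≤ m ≤ M` (`WeilComb.log_add_sum_vonMangoldt_div_le`, from
Rosser–Schoenfeld (3.24): `ψ₁(y) = Σ_{n ≤ y} Λ(n)/n < log y + 1`,
`RosserSchoenfeld.sum_vonMangoldt_div_lt_log_add_one`, with `log m + log(M/m) = log M`). -/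
theorem stub_helson_upper : ∀ (M : ℕ) (a : ℕ → ℂ),
    2 * (∑ m ∈ Finset.Icc 1 M, ∑ n ∈ Finset.Icc 1 (M / m),
        ((ArithmeticFunction.vonMangoldt n : ℝ) : ℂ) / (Real.sqrt n : ℂ) * a (n * m) * conj (a m)).re ≤
      (Real.log M + 1) * (∑ m ∈ Finset.Icc 1 M, ‖a m‖ ^ 2) -
        ∑ m ∈ Finset.Icc 1 M, ∑ n ∈ Finset.Icc 1 (M / m),
          (ArithmeticFunction.vonMangoldt n : ℝ) * ‖a (n * m) - ((Real.sqrt n : ℂ))⁻¹ * a m‖ ^ 2 := by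
  intro M a
  rw [WeilCombSubcritical.stub_identity M a]
  refine sub_le_sub_right ?_ _
  rw [Finset.mul_sum]
  refine Finset.sum_le_sum fun m hm => ?_
  rw [mul_comm]
  exact mul_le_mul_of_nonneg_right (WeilComb.log_add_sum_vonMangoldt_div_le hm) (sq_nonneg _)

end Summit.RiemannHypothesis.RiemannHypothesis.Theorems.WeilCombBohrFejer

end
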